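import Literature.AlgebraicGeometry.Resolution.DifferentialOperators
import Mathlib.RingTheory.MvPolynomial.Homogeneous
import Mathlib.Algebra.CharP.Lemmas
import Mathlib.Algebra.CharP.Algebra
import Mathlib.FieldTheory.Perfect
import Mathlib.LinearAlgebra.Dimension.Finrank
import HarnessLib

/-!
# Hironaka's additive group schemes: invariant additive forms, exponent, dimension; Mizutani's `m(e)`

Topic: `Literature/AlgebraicGeometry/Resolution`; sub-namespace `HironakaScheme`.  Statement-level
vocabulary (no theorems claimed) for H. Hironaka's additive group schemes `B(𝔭)` attached to the
points `𝔭` of a projective space over a field `k` of characteristic `p > 0`, in T. Oda's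
linear-algebraic description, and the number `m(e)` of H. Mizutani with his conjecture
`m(e) = 2p^e − 1` (Nagoya Math. J. 52 (1973), Remark 2.10).  Written for the pub-rosobs cell's
Lean transcription of its in-house note on that conjecture (AI-written; *AI review is weaker than
expert review*); nothing here is a resolution theorem.

## What is transcribed (Oda, Publ. RIMS 19 (1983), §2, p. 1168; Mizutani 1973 §1)

Let `S = k[X_0, …, X_n]`, `L_e ⊂ S_{p^e}` the `k`-space of ADDITIVE (purely inseparable) FORMS
`Σ_j a_j X_j^{p^e}` of degree `p^e`, `L = ⊕_e L_e` (a graded left `k[F]`-module, `F` = `p`-th power).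
To a homogeneous prime `𝔭 ≠ S_+` Hironaka attaches the homogeneous additive subgroup scheme
`B(𝔭) ⊂ Spec S`; it is determined by the graded `k[F]`-submodule `L_B ⊂ L` of `B(𝔭)`-invariant
additive forms, and (Oda 1973 Prop. 2.2 (ii), quoted on p. 1168 of Oda 1983-II)
`(L_B)_e = {h ∈ L_e : D h ∈ 𝔭 for all D ∈ Diff_{p^e − 1}(k / k^{p^e})}`, the differential operators of
`k` over its subfield of `p^e`-th powers, of order `≤ p^e − 1`, acting on the COEFFICIENTS of `h`.
"`exponent(L_B) ≤ e`" means `k·F^{j−e}(L_B)_e = (L_B)_j` for all `j ≥ e`; "the dimension of `B(𝔭)`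
equals the rank of `L/L_B` as a module over `k[F]`" (p. 1168), i.e. `n + 1 −` the eventual value of
`dim_k (L_B)_j` (Mizutani 1973 Thm. 1.3: `dim B = dim_k(L_e/N_e)`).

We take these PRINTED DESCRIPTIONS as the DEFINITIONS (on coefficient vectors `a : Fin (n+1) → k`):
`invForms k p 𝔭 e` (`= (L_B)_e`), `ExponentLE`, `hsDimAt`; `IsPoint 𝔭` (homogeneous prime, not the
irrelevant ideal).  Their agreement with Hironaka's original definition of `B(𝔭)` (Ann. of Math. 92
(1970)) is Oda's cited theorem, not re-proved IN THIS FILE.  Named facts (Mizutani, proved in print):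
`Mizutani1973_m_one` (`m(1) ≥ 2p − 1`, Thm. 2.8) and the ATTAINMENT `MizutaniAttained p e` (his
schemes `H_e` of exponent `e` and dimension `2p^e − 1`, Remark 2.10).  The general lower bound
`m(e) ≥ 2p^e − 1` (Remark 2.10: "it is quite likely that `m(e) = 2p^e − 1`") is NOT a published
theorem and is filed summit-side as an obligation
(`Summits/ResolutionOfSingularities/KangarooAtlas/MizutaniConjecture.lean`).

STATUS OF THESE ITEMS IN THE TREE (2026-08-27; summit-side files of the cell pub-rosobs, directory
`Summits/ResolutionOfSingularities/KangarooAtlas/`, namespace `Summit.ResolutionOfSingularities.KangarooAtlas.Mizutani`;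
AI-written, *AI review is weaker than expert review*): the obligation is PROVED (`mizutaniLowerBound`,
`mizutaniConjecture`, `mizutaniNumber_eq : m(e) = 2p^e − 1`; files `MizutaniLowerBound`, `MizutaniConjectureHolds`,
`MizutaniNumber`); both named facts below are DISCHARGED (`mizutani1973_m_one : Mizutani1973_m_one p`,
`mizutaniAttained : MizutaniAttained p e`, and field by field `mizutaniAttained_of_lt_rank`); the agreement with
Hironaka's / Mizutani's own objects (`U(𝔭)`, `B_{P,𝔭} = Spec S/U_+(𝔭)S`, typed in `HironakaGroupSchemeMultiplicity.lean`)
is PROVED: `hirForms_eq_invForms` (`(L_B)_e = U(𝔭) ∩ L_e`, Oda 1973 Prop. 2.2 (ii); `MizutaniOdaEquality`),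
`ringKrullDim_quotient_bIdeal_eq_hsDim_holds` (`hsDim` is the Krull dimension of `S ⧸ U_+(𝔭)S`, Mizutani Thm. 1.3;
`MizutaniHironakaSide`, using res-hironaka's `Hironaka1970_thm1_cor_holds`), `schemeIdeal_eq_bIdeal` (`MizutaniSchemeIdentity`),
and `B_{P,𝔭}` is a homogeneous additive subgroup scheme with Hironaka's edge datum computing `exponent` and `dim`
(`MizutaniGroupScheme`, `MizutaniTriangular`, `MizutaniEdgeDatum[Bound]`).  The definitions of this file are unchanged.

References: [Oda1983HironakaGroupSchemeII] §2 (p. 1168), Cor. 2.3 (p. 1171);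
[Mizutani1973HironakaGroupSchemes] §1 (Def. 1.1, (c), Thm. 1.3), Thm. 2.8, Remark 2.10;
[EGAIV4] §16.8 (differential operators, via the tree's `IsDiffOpLE`).
-/

open MvPolynomial

namespace Literature.AlgebraicGeometry.Resolution.HironakaScheme

universe u

section Defs

variable (k : Type u) [Field k] (p : ℕ) [Fact p.Prime] [CharP k p] {n : ℕ}

/-- The subfield `k^{p^e} = F^e(k)` of `p^e`-th powers. [cite: Oda1983HironakaGroupSchemeII, §1 (p. 1164: F the p-th power Frobenius, F^{-e}(k)) and §2 (p. 1168: F^e(k))] -/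
noncomputable def frobPow (e : ℕ) : Subfield k := (iterateFrobenius k p e).fieldRange

/-- The ADDITIVE FORM `Σ_j a_j X_j^{p^e} ∈ L_e ⊂ S_{p^e}` with coefficient vector `a` (the purely
inseparable forms of degree `p^e`; `L = ⊕_e L_e`). [cite: Oda1983HironakaGroupSchemeII, §2 (p. 1167–1168: L_e, L = k[F] ⊗_k L_0)] -/
noncomputable def addForm (e : ℕ) (a : Fin (n + 1) → k) : MvPolynomial (Fin (n + 1)) k :=
  ∑ j, C (a j) * X j ^ p ^ e

/-- The Frobenius `F^m : L_e → L_{e+m}` on coefficient vectors: `(a_j) ↦ (a_j^{p^m})`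
(`(Σ a_j X_j^{p^e})^{p^m} = Σ a_j^{p^m} X_j^{p^{e+m}}`). [cite: Oda1983HironakaGroupSchemeII, §2 (p. 1168: L a graded left k[F]-module, F the p-th power map)] -/
def frobVec (m : ℕ) (a : Fin (n + 1) → k) : Fin (n + 1) → k := fun j => a j ^ p ^ m

/-- A differential operator of `k` into itself OVER THE SUBFIELD `k^{p^e}` of order `≤ m`
(Grothendieck's sense, the tree's `IsDiffOpLE`), acting on additive forms through their
coefficients. [cite: Oda1983HironakaGroupSchemeII, §2 (p. 1168: Diff_{p^e−1}(k/F^e(k)) acting on the coefficients of elements of L_e)] -/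
def IsCoeffDiffOp (e m : ℕ) (D : k →ₗ[frobPow k p e] k) : Prop :=
  IsDiffOpLE (frobPow k p e) m D

/-- **Oda's module of `B(𝔭)`-invariant additive forms**, degree-`p^e` part, on coefficient vectors:
`(L_B)_e = {h ∈ L_e : D h ∈ 𝔭 for every D ∈ Diff_{p^e−1}(k/k^{p^e})}` (Oda 1973 Prop. 2.2 (ii) as
quoted in Oda 1983-II; taken here as the DEFINITION of the invariant forms of the Hironaka subgroup
scheme `B(𝔭)`). [cite: Oda1983HironakaGroupSchemeII, §2 (p. 1168, display: (L_B)_e = {h ∈ L_e ; D h ∈ 𝔭 ∩ L_e for all D ∈ Diff_{p^e−1}(k/F^e(k))})] -/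
noncomputable def invForms (𝔭 : Ideal (MvPolynomial (Fin (n + 1)) k)) (e : ℕ) :
    Submodule k (Fin (n + 1) → k) where
  carrier := {a | ∀ D : k →ₗ[frobPow k p e] k, IsCoeffDiffOp k p e (p ^ e - 1) D →
    addForm k p e (fun j => D (a j)) ∈ 𝔭}
  zero_mem' := by
    intro D _
    simp only [Pi.zero_apply, map_zero, addForm, zero_mul, Finset.sum_const_zero]
    exact Ideal.zero_mem 𝔭
  add_mem' := by
    intro a b ha hb D hD
    have h := Ideal.add_mem 𝔭 (ha D hD) (hb D hD)
    simp only [addForm, Pi.add_apply, map_add, add_mul, Finset.sum_add_distrib] at h ⊢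
    exact h
  smul_mem' := by
    intro c a ha D hD
    -- `D ∘ (c ·)` is again a differential operator of order `≤ p^e − 1` over `k^{p^e}`
    have hD' : IsCoeffDiffOp k p e (p ^ e - 1) (D ∘ₗ LinearMap.mulLeft (frobPow k p e) c) := by
      unfold IsCoeffDiffOp
      have := IsDiffOpLE.comp hD (isDiffOpLE_mulLeft (R := frobPow k p e) (A := k) c)
      simpa using this
    have h := ha _ hD'
    simpa [addForm, smul_eq_mul] using h

/-- **`exponent(B(𝔭)) ≤ e`**: the invariant forms are generated, as a `k[F]`-module, in degrees `≤ e`,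
i.e. `(L_B)_j = k · F^{j−e} (L_B)_e` for all `j ≥ e` (Oda) — equivalently Mizutani's exponent
`e(Q)` of the graded `k[F]`-module `Q = L_B` is `≤ e`. [cite: Oda1983HironakaGroupSchemeII, §2 (p. 1168: "Q is said to be of exponent not greater than e … i.e., kF^{j−e}Q_e = Q_j for all j ≥ e")] -/
def ExponentLE (𝔭 : Ideal (MvPolynomial (Fin (n + 1)) k)) (e : ℕ) : Prop :=
  ∀ j, e ≤ j → invForms k p 𝔭 j = Submodule.span k (frobVec k p (j - e) '' (invForms k p 𝔭 e))

/-- **The dimension of `B(𝔭)`, read at level `e₀`**: `n + 1 − dim_k (L_B)_{e₀}` — Oda: "the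
dimension of `B(𝔭)` equals the rank of `L/L_B` as a module over `k[F]`", Mizutani 1973 Thm. 1.3:
`dim B = dim_k (L_e/N_e)` for `e` the exponent; for any `e₀ ≥ exponent` the value is the same
(`(L_B)_{e₀} = k·F^{e₀−e}(L_B)_e` and `F` is injective semilinear).  Taken as the definition; used
below only at levels `e₀` with `ExponentLE 𝔭 e₀`.
[cite: Oda1983HironakaGroupSchemeII, §2 (p. 1168: "The dimension of B(𝔭) equals the rank of L/L_B as a module over k[F]")] -/
noncomputable def hsDimAt (𝔭 : Ideal (MvPolynomial (Fin (n + 1)) k)) (e₀ : ℕ) : ℕ :=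
  (n + 1) - Module.finrank k (invForms k p 𝔭 e₀)

/-- `dim_k (L_B)_e ≤ n + 1 = dim_k L_e` (so the subtraction in `hsDimAt` never truncates). [cite: Oda1983HironakaGroupSchemeII, §2 (p. 1168: L_B ⊂ L, L_e ≅ k ⊗ F^e(L_0) of dimension n + 1)] -/
theorem finrank_invForms_le (𝔭 : Ideal (MvPolynomial (Fin (n + 1)) k)) (e : ℕ) :
    Module.finrank k (invForms k p 𝔭 e) ≤ n + 1 := by
  have h := Submodule.finrank_le (invForms k p 𝔭 e)
  rw [Module.finrank_pi, Fintype.card_fin] at h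
  exact h

/-- The irrelevant ideal `S_+ = (X_0, …, X_n)` of `S = k[X_0, …, X_n]`. [cite: Oda1983HironakaGroupSchemeII, §2 (p. 1168: S_+ := ⊕_{ν>0} S_ν)] -/
noncomputable def irrelevant (n : ℕ) : Ideal (MvPolynomial (Fin (n + 1)) k) :=
  RingHom.ker (constantCoeff : MvPolynomial (Fin (n + 1)) k →+* k)

/-- A POINT of `ℙ^n_k` in the sense used by Oda: a homogeneous prime ideal `𝔭 ≠ S_+` of `S`
(closed under taking homogeneous components; proper and not containing the irrelevant ideal, so
that it is a point of `Proj S`, closed or not). [cite: Oda1983HironakaGroupSchemeII, §2 (p. 1168: "a homogeneous prime ideal 𝔭 of S with 𝔭 ≠ S_+")] -/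
def IsPoint (𝔭 : Ideal (MvPolynomial (Fin (n + 1)) k)) : Prop :=
  𝔭.IsPrime ∧ (∀ f ∈ 𝔭, ∀ d : ℕ, homogeneousComponent d f ∈ 𝔭) ∧ ¬ irrelevant k n ≤ 𝔭

end Defs

section Statements

/-- **Mizutani's theorem `m(1) ≥ 2p − 1`** (Nagoya Math. J. 52 (1973), Thm. 2.8 with Remark 2.10:
"This is in fact the case for `e = 1`"): for every field `k` of characteristic `p`, every `n` and every
point `𝔭` of `ℙ^n_k` whose Hironaka subgroup scheme `B(𝔭)` has finite exponent `e₀ ≥ 1` (i.e. is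
NOT a vector group, Remark 1.2), `dim B(𝔭) ≥ 2p − 1` (dimension read at the level `e₀`).  A NAMED
FACT, not re-proved here; DISCHARGED summit-side by
`Summit.ResolutionOfSingularities.KangarooAtlas.Mizutani.mizutani1973_m_one` (`KangarooAtlas/MizutaniConjectureHolds.lean`,
the case `e = 1` of `mizutaniLowerBound`).  (The general-`e` statement `m(e) ≥ 2p^e − 1` is Mizutani's Remark 2.10
question, filed summit-side as an obligation and proved there: `mizutaniLowerBound`.)
[cite: Mizutani1973HironakaGroupSchemes, Theorem 2.8 and Remark 2.10] -/
def Mizutani1973_m_one (p : ℕ) [Fact p.Prime] : Prop :=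
  ∀ (k : Type u) [Field k] [CharP k p] (n : ℕ) (𝔭 : Ideal (MvPolynomial (Fin (n + 1)) k)) (e₀ : ℕ),
    IsPoint k 𝔭 → ExponentLE k p 𝔭 e₀ → ¬ ExponentLE k p 𝔭 0 → 2 * p ≤ hsDimAt k p 𝔭 e₀ + 1

/-- **Attainment `m(e) ≤ 2p^e − 1`** (Mizutani's schemes `H_e`, `e ≥ 1`): there are a field `k` of
characteristic `p`, an `n` and a point `𝔭` of `ℙ^n_k` whose Hironaka subgroup scheme has exponent
exactly `e` and dimension `2p^e − 1` ("inductively we can construct examples H_2, H_3, …, H_e such that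
e(H_e) = e and dim H_e = 2p^e − 1"; `[k : k^p] ≥ p²` suffices; `e = 1` is Example 2.1, due to Oda).
A NAMED FACT, not re-proved here; DISCHARGED summit-side by
`Summit.ResolutionOfSingularities.KangarooAtlas.Mizutani.mizutaniAttained` (`KangarooAtlas/MizutaniAttained.lean`, over
`𝔽_p(u_0,u_1)`) and, over every field with `[k : k^p] > p`, `mizutaniAttained_of_lt_rank` (`MizutaniAttainedGeneral.lean`).
[cite: Mizutani1973HironakaGroupSchemes, Remark 2.10 (the schemes H_e) and Example 2.1] -/
def MizutaniAttained (p : ℕ) [Fact p.Prime] (e : ℕ) : Prop :=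
  ∃ (k : Type u) (_ : Field k) (_ : CharP k p) (n : ℕ) (𝔭 : Ideal (MvPolynomial (Fin (n + 1)) k)),
    IsPoint k 𝔭 ∧ ExponentLE k p 𝔭 e ∧ (∀ e', e' < e → ¬ ExponentLE k p 𝔭 e') ∧
      hsDimAt k p 𝔭 e + 1 = 2 * p ^ e

end Statements

end Literature.AlgebraicGeometry.Resolution.HironakaScheme
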